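import Summits.ValiantsHypothesis.ValiantsHypothesis.Theorems.FeketeSOSFeketeSOSHardPaleyRIPIntervalExp
import Mathlib.Algebra.Polynomial.Expand
import Mathlib.Algebra.BigOperators.Ring.Finset

/-!
# Route FeketeSOS — crux `FeketeSOSHard` (stmt-ValiantsHypothesis-3996), line `paley-rip` v3,
# `stub_tameOperator` piece (B), structured supports beyond intervals: AP blocks `O(log k)`,
# proper rank-two progression blocks `O(log k₁ · log k₂)`

The structure-theorem programme for `stub_tameOperator` at `r = 2` (`Cruxes/FeketeSOSHard/Lines/paley-rip-stub3-census.md`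
§6 W5(b)) wants the structured part of a support to be covered by "few short intervals / GAP pieces", each carrying
cheap preimages of exponential patterns.  `…PaleyRIPIntervalExp.lean` does intervals; this file transports the
same representations to arithmetic progressions and to proper rank-two generalised progressions at no loss:

* `rep_expand` — dilation `X ↦ X^q` (`Polynomial.expand`) keeps masses (`sqMass_expand`) and scales supports;
  `exp_apBlock_rep`: on `(d + q·[0,k)) ∪ (d' + q·[0,k))` the pattern `X^{d+d'} Σ_{n<2k−1} u^n X^{qn}` costs
  `≤ Nat.log 2 k + 5/2`;
* `rep_mul` — PRODUCTS: representations on `A` and `B` multiply to one on `A + B` with mass `≤ m_F · m_G`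
  whenever `A + B` is proper (`coeff_mul_of_proper`, `sqMass_mul_of_proper`: `‖w v‖₂ = ‖w‖₂ ‖v‖₂`);
  `exp_gapBlock_rep`: on a proper rank-two progression `P = [0,k₁) + q·[0,k₂)` (`q ≥ k₁`) every product
  exponential pattern on `(d + P) + (d' + P)` costs `≤ (Nat.log 2 k₁ + 5/2)(Nat.log 2 k₂ + 5/2)`;
* `rep_shift_two'` — the two-sided shift of `…IntervalExp` for an arbitrary support set.

Honest framing (rung currency): Theorems-side helpers `--supports` stmt-3996; they price the STRUCTURED pieces only
and say nothing about cluster-free supports, `stub_tameOperator` (r ≥ 2), `stub_paleyFlatRIP` or the crux,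
which stay OPEN; `VP ≠ VNP` is untouched.
-/

set_option linter.dupNamespace false

namespace Summit.ValiantsHypothesis.ValiantsHypothesis.Theorems.FeketeSOSHardPaleyRIP

open Polynomial Finset
open scoped BigOperators

noncomputable section

/-! ## Arithmetic progressions and rank-two progressions (dilation `X ↦ X^q`, proper products) -/

/-- The archimedean mass of a weighted square is nonnegative. [folklore] -/
theorem sqMass_nonneg (c : ℂ) (w : ℂ[X]) : 0 ≤ sqMass c w := by
  unfold sqMass
  exact mul_nonneg (norm_nonneg _) (Finset.sum_nonneg fun _ _ => sq_nonneg _)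

/-- Dilation `X ↦ X^q` (`q ≥ 1`) preserves the mass of a weighted square. [folklore] -/
theorem sqMass_expand (c : ℂ) (w : ℂ[X]) {q : ℕ} (hq : 0 < q) :
    sqMass c (expand ℂ q w) = sqMass c w := by
  classical
  have hsub : (expand ℂ q w).support ⊆ w.support.image (fun a => q * a) := by
    intro n hn
    rw [mem_support_iff, coeff_expand hq] at hn
    by_cases hdvd : q ∣ n
    · rw [if_pos hdvd] at hn
      exact Finset.mem_image.2 ⟨n / q, mem_support_iff.2 hn, Nat.mul_div_cancel' hdvd⟩
    · exact absurd (if_neg hdvd) hn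
  rw [sqMass_eq_of_support_subset c _ _ hsub,
    Finset.sum_image fun a _ b _ h => (mul_right_injective₀ hq.ne') h]
  unfold sqMass
  congr 1
  refine Finset.sum_congr rfl fun a _ => ?_
  rw [coeff_expand_mul' hq]

/-- **Dilation.**  A representation of `F` with supports in `T` dilates (`X ↦ X^q`) to one of `F(X^q)` with
supports in `q · T` and the same mass. [folklore] -/
theorem rep_expand {T : Finset ℕ} {F : ℂ[X]} {m : ℝ} {q : ℕ} (hq : 0 < q)
    (h : ∃ (s : ℕ) (c : Fin s → ℂ) (w : Fin s → ℂ[X]), (∀ j, (w j).support ⊆ T) ∧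
      (∑ j, C (c j) * w j ^ 2) = F ∧ (∑ j, sqMass (c j) (w j)) ≤ m) :
    ∃ (s : ℕ) (c : Fin s → ℂ) (w : Fin s → ℂ[X]), (∀ j, (w j).support ⊆ T.image (fun a => q * a)) ∧
      (∑ j, C (c j) * w j ^ 2) = expand ℂ q F ∧ (∑ j, sqMass (c j) (w j)) ≤ m := by
  classical
  obtain ⟨s, c, w, h1, h2, h3⟩ := h
  refine ⟨s, c, fun j => expand ℂ q (w j), ?_, ?_, ?_⟩
  · intro j n hn
    rw [mem_support_iff, coeff_expand hq] at hn
    by_cases hdvd : q ∣ n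
    · rw [if_pos hdvd] at hn
      exact Finset.mem_image.2 ⟨n / q, h1 j (mem_support_iff.2 hn), Nat.mul_div_cancel' hdvd⟩
    · exact absurd (if_neg hdvd) hn
  · rw [← h2, map_sum]
    exact Finset.sum_congr rfl fun j _ => by rw [map_mul, expand_C, map_pow]
  · simpa only [sqMass_expand _ _ hq] using h3

/-- Support of a shift (general support set): every exponent of `X^d w` is `d + a` with `a ∈ A ⊇ supp w`. [folklore] -/
theorem exists_mem_of_mem_support_X_pow_mul {A : Finset ℕ} {d : ℕ} {w : ℂ[X]} (hw : w.support ⊆ A) {n : ℕ}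
    (hn : n ∈ (X ^ d * w).support) : ∃ a ∈ A, n = d + a := by
  rw [mem_support_iff, coeff_X_pow_mul'] at hn
  by_cases hd : d ≤ n
  · rw [if_pos hd] at hn
    exact ⟨n - d, hw (mem_support_iff.2 hn), by omega⟩
  · exact absurd (if_neg hd) hn

/-- **Two-sided shift, general support set** (as `rep_shift_two`, with `[0,k)` replaced by any finite `A`):
a representation of `F` by squares supported in `A` yields, for `T ⊇ (d + A) ∪ (d' + A)`, one of `X^{d+d'} F`
by squares supported in `T`, of the same mass. [folklore] -/
theorem rep_shift_two' {A : Finset ℕ} {F : ℂ[X]} {m : ℝ} (d d' : ℕ) (T : Finset ℕ)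
    (hd : ∀ a ∈ A, d + a ∈ T) (hd' : ∀ a ∈ A, d' + a ∈ T)
    (h : ∃ (s : ℕ) (c : Fin s → ℂ) (w : Fin s → ℂ[X]), (∀ j, (w j).support ⊆ A) ∧
      (∑ j, C (c j) * w j ^ 2) = F ∧ (∑ j, sqMass (c j) (w j)) ≤ m) :
    ∃ (s : ℕ) (c : Fin s → ℂ) (w : Fin s → ℂ[X]), (∀ j, (w j).support ⊆ T) ∧
      (∑ j, C (c j) * w j ^ 2) = X ^ (d + d') * F ∧ (∑ j, sqMass (c j) (w j)) ≤ m := by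
  obtain ⟨s, c, w, h1, h2, h3⟩ := h
  have hsd : ∀ j, (X ^ d * w j).support ⊆ T := fun j n hn => by
    obtain ⟨a, ha, rfl⟩ := exists_mem_of_mem_support_X_pow_mul (h1 j) hn
    exact hd a ha
  have hsd' : ∀ j, (X ^ d' * w j).support ⊆ T := fun j n hn => by
    obtain ⟨a, ha, rfl⟩ := exists_mem_of_mem_support_X_pow_mul (h1 j) hn
    exact hd' a ha
  have hsp : ∀ j, (X ^ d * w j + X ^ d' * w j).support ⊆ T := fun j =>
    (support_add).trans (Finset.union_subset (hsd j) (hsd' j))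
  have hsm : ∀ j, (X ^ d * w j - X ^ d' * w j).support ⊆ T := fun j => by
    rw [sub_eq_add_neg]
    refine (support_add).trans (Finset.union_subset (hsd j) ?_)
    rw [support_neg]; exact hsd' j
  have hone : ∀ j, ∃ (s' : ℕ) (c' : Fin s' → ℂ) (w' : Fin s' → ℂ[X]), (∀ i, (w' i).support ⊆ T) ∧
      (∑ i, C (c' i) * w' i ^ 2) = X ^ (d + d') * (C (c j) * w j ^ 2) ∧
      (∑ i, sqMass (c' i) (w' i)) ≤ sqMass (c j) (w j) := by
    intro j
    have hp := rep_single T (c j / 4) _ (hsp j) le_rfl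
    have hm := rep_single T (-(c j / 4)) _ (hsm j) le_rfl
    refine rep_congr ?_ ?_ (rep_add hp hm)
    · have h4 : C ((4 : ℂ)⁻¹) * 4 = (1 : ℂ[X]) := by
        rw [show (4 : ℂ[X]) = C (4 : ℂ) from rfl, ← C_mul, inv_mul_cancel₀ (by norm_num), C_1]
      rw [C_neg, div_eq_mul_inv, C_mul]
      linear_combination (C (c j) * X ^ (d + d') * w j ^ 2) * h4
    · rw [sqMass_eq_of_support_subset _ _ T (hsp j), sqMass_eq_of_support_subset _ _ T (hsm j), norm_neg,
        ← mul_add, ← Finset.sum_add_distrib]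
      have hpar : ∀ n ∈ T, ‖(X ^ d * w j + X ^ d' * w j).coeff n‖ ^ 2 + ‖(X ^ d * w j - X ^ d' * w j).coeff n‖ ^ 2
          = 2 * (‖(X ^ d * w j).coeff n‖ ^ 2 + ‖(X ^ d' * w j).coeff n‖ ^ 2) := by
        intro n _
        rw [coeff_add, coeff_sub]
        have := parallelogram_law_with_norm ℂ ((X ^ d * w j).coeff n) ((X ^ d' * w j).coeff n)
        nlinarith [this]
      rw [Finset.sum_congr rfl hpar, ← Finset.mul_sum, Finset.sum_add_distrib,
        sum_normSq_coeff_X_pow_mul d (w j) T (hsd j), sum_normSq_coeff_X_pow_mul d' (w j) T (hsd' j)]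
      unfold sqMass
      rw [norm_div, show ‖(4 : ℂ)‖ = 4 by simp]
      apply le_of_eq
      ring
  have hall := rep_sum (Finset.univ : Finset (Fin s)) T (fun j => X ^ (d + d') * (C (c j) * w j ^ 2))
    (fun j => sqMass (c j) (w j)) fun j _ => hone j
  refine rep_congr ?_ h3 hall
  rw [← Finset.mul_sum, h2]

/-- **Exponential patterns on an arithmetic-progression block are cheap.**  For `k ≥ 1`, step `q ≥ 1`,
`|u| = 1`, shifts `d, d'` and `S ⊇ (d + q·[0,k)) ∪ (d' + q·[0,k))`: the pattern `X^{d+d'} Σ_{n<2k−1} u^n X^{qn}`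
is `Σ_j c_j w_j²` with `supp w_j ⊆ S` and mass `≤ Nat.log 2 k + 5/2` (dilate `exp_rep`, then shift). [folklore] -/
theorem exp_apBlock_rep (k q : ℕ) (hk : 1 ≤ k) (hq : 0 < q) (u : ℂ) (hu : ‖u‖ = 1) (d d' : ℕ) (S : Finset ℕ)
    (hd : ∀ i, i < k → d + q * i ∈ S) (hd' : ∀ i, i < k → d' + q * i ∈ S) :
    ∃ (s : ℕ) (c : Fin s → ℂ) (w : Fin s → ℂ[X]), (∀ j, (w j).support ⊆ S) ∧
      (∑ j, C (c j) * w j ^ 2) =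
        X ^ (d + d') * ∑ n ∈ range (2 * k - 1), C (u ^ n) * (X : ℂ[X]) ^ (q * n) ∧
      (∑ j, sqMass (c j) (w j)) ≤ (Nat.log 2 k : ℝ) + 5 / 2 := by
  classical
  have h := rep_expand hq (exp_rep k hk u hu)
  have hpat : expand ℂ q (∑ n ∈ range (2 * k - 1), C (u ^ n) * (X : ℂ[X]) ^ n) =
      ∑ n ∈ range (2 * k - 1), C (u ^ n) * (X : ℂ[X]) ^ (q * n) := by
    rw [map_sum]
    exact Finset.sum_congr rfl fun n _ => by rw [map_mul, expand_C, map_pow (expand ℂ q), expand_X, ← pow_mul]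
  refine rep_shift_two' d d' S ?_ ?_ (rep_congr hpat le_rfl h)
  · intro a ha
    obtain ⟨i, hi, rfl⟩ := Finset.mem_image.1 ha
    exact hd i (mem_range.1 hi)
  · intro a ha
    obtain ⟨i, hi, rfl⟩ := Finset.mem_image.1 ha
    exact hd' i (mem_range.1 hi)

/-- On a PROPER sumset `A + B` (each `n` has at most one representation `a + b`), the coefficients of a product
of polynomials supported in `A` and `B` are products of coefficients. [folklore] -/
theorem coeff_mul_of_proper {A B : Finset ℕ}
    (hprop : ∀ a₁ ∈ A, ∀ b₁ ∈ B, ∀ a₂ ∈ A, ∀ b₂ ∈ B, a₁ + b₁ = a₂ + b₂ → a₁ = a₂)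
    {w v : ℂ[X]} (hw : w.support ⊆ A) (hv : v.support ⊆ B) {a b : ℕ} (ha : a ∈ A) (hb : b ∈ B) :
    (w * v).coeff (a + b) = w.coeff a * v.coeff b := by
  rw [coeff_mul]
  refine Finset.sum_eq_single (a, b) ?_ ?_
  · rintro ⟨a', b'⟩ hx hne
    rw [Finset.mem_antidiagonal] at hx
    by_cases ha' : a' ∈ w.support
    · by_cases hb' : b' ∈ v.support
      · exfalso
        have h1 := hprop a' (hw ha') b' (hv hb') a ha b hb hx
        apply hne
        have h2 : b' = b := by omega
        rw [h1, h2]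
      · show w.coeff a' * v.coeff b' = 0
        rw [notMem_support_iff.1 hb', mul_zero]
    · show w.coeff a' * v.coeff b' = 0
      rw [notMem_support_iff.1 ha', zero_mul]
  · intro h
    exact (h (Finset.mem_antidiagonal.2 rfl)).elim

/-- The support of a product is inside the sumset of the supports. [folklore] -/
theorem support_mul_subset_image {A B : Finset ℕ} {w v : ℂ[X]} (hw : w.support ⊆ A) (hv : v.support ⊆ B) :
    (w * v).support ⊆ (A ×ˢ B).image (fun x => x.1 + x.2) := by
  classical
  intro n hn
  rw [mem_support_iff, coeff_mul] at hn
  obtain ⟨x, hx, hne⟩ := Finset.exists_ne_zero_of_sum_ne_zero hn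
  rw [Finset.mem_antidiagonal] at hx
  have h1 : x.1 ∈ w.support := mem_support_iff.2 fun h => hne (by rw [h, zero_mul])
  have h2 : x.2 ∈ v.support := mem_support_iff.2 fun h => hne (by rw [h, mul_zero])
  exact Finset.mem_image.2 ⟨x, Finset.mem_product.2 ⟨hw h1, hv h2⟩, hx⟩

/-- **Masses multiply on proper sumsets**: `sqMass (c c') (w v) = sqMass c w · sqMass c' v` when
`supp w ⊆ A`, `supp v ⊆ B` and `A + B` is proper. [folklore] -/
theorem sqMass_mul_of_proper {A B : Finset ℕ}
    (hprop : ∀ a₁ ∈ A, ∀ b₁ ∈ B, ∀ a₂ ∈ A, ∀ b₂ ∈ B, a₁ + b₁ = a₂ + b₂ → a₁ = a₂)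
    {w v : ℂ[X]} (hw : w.support ⊆ A) (hv : v.support ⊆ B) (c c' : ℂ) :
    sqMass (c * c') (w * v) = sqMass c w * sqMass c' v := by
  classical
  rw [sqMass_eq_of_support_subset _ _ _ (support_mul_subset_image hw hv),
    sqMass_eq_of_support_subset c w A hw, sqMass_eq_of_support_subset c' v B hv, norm_mul]
  have hinj : Set.InjOn (fun x : ℕ × ℕ => x.1 + x.2) ↑(A ×ˢ B) := by
    rintro ⟨a₁, b₁⟩ h₁ ⟨a₂, b₂⟩ h₂ heq
    rw [Finset.coe_product, Set.mem_prod, Finset.mem_coe, Finset.mem_coe] at h₁ h₂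
    have ha := hprop a₁ h₁.1 b₁ h₁.2 a₂ h₂.1 b₂ h₂.2 heq
    have hb : b₁ = b₂ := by simp only at heq; omega
    rw [ha, hb]
  rw [Finset.sum_image hinj, Finset.sum_product]
  have key : ∀ a ∈ A, ∀ b ∈ B, ‖(w * v).coeff ((a, b).1 + (a, b).2)‖ ^ 2 = ‖w.coeff a‖ ^ 2 * ‖v.coeff b‖ ^ 2 := by
    intro a ha b hb
    rw [coeff_mul_of_proper hprop hw hv ha hb, norm_mul, mul_pow]
  rw [Finset.sum_congr rfl fun a ha => Finset.sum_congr rfl fun b hb => key a ha b hb,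
    show (‖c‖ * ∑ a ∈ A, ‖w.coeff a‖ ^ 2) * (‖c'‖ * ∑ b ∈ B, ‖v.coeff b‖ ^ 2) =
      ‖c‖ * ‖c'‖ * ((∑ a ∈ A, ‖w.coeff a‖ ^ 2) * ∑ b ∈ B, ‖v.coeff b‖ ^ 2) by ring,
    Finset.sum_mul_sum]

/-- **Products.**  Representations of `F` (supports in `A`, mass `≤ m_F`) and `G` (supports in `B`, mass
`≤ m_G`) multiply to one of `F·G` with supports in any `T ⊇ A + B` and mass `≤ m_F m_G`, provided `A + B` is
proper (then `‖w v‖₂ = ‖w‖₂‖v‖₂`). [folklore] -/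
theorem rep_mul {A B T : Finset ℕ} {F G : ℂ[X]} {mF mG : ℝ}
    (hprop : ∀ a₁ ∈ A, ∀ b₁ ∈ B, ∀ a₂ ∈ A, ∀ b₂ ∈ B, a₁ + b₁ = a₂ + b₂ → a₁ = a₂)
    (hT : ∀ a ∈ A, ∀ b ∈ B, a + b ∈ T)
    (hF : ∃ (s : ℕ) (c : Fin s → ℂ) (w : Fin s → ℂ[X]), (∀ j, (w j).support ⊆ A) ∧
      (∑ j, C (c j) * w j ^ 2) = F ∧ (∑ j, sqMass (c j) (w j)) ≤ mF)
    (hG : ∃ (s : ℕ) (c : Fin s → ℂ) (w : Fin s → ℂ[X]), (∀ j, (w j).support ⊆ B) ∧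
      (∑ j, C (c j) * w j ^ 2) = G ∧ (∑ j, sqMass (c j) (w j)) ≤ mG) :
    ∃ (s : ℕ) (c : Fin s → ℂ) (w : Fin s → ℂ[X]), (∀ j, (w j).support ⊆ T) ∧
      (∑ j, C (c j) * w j ^ 2) = F * G ∧ (∑ j, sqMass (c j) (w j)) ≤ mF * mG := by
  classical
  obtain ⟨s, c, w, h1, h2, h3⟩ := hF
  obtain ⟨s', c', v, h1', h2', h3'⟩ := hG
  have hone : ∀ i j, ∃ (s₀ : ℕ) (c₀ : Fin s₀ → ℂ) (w₀ : Fin s₀ → ℂ[X]), (∀ l, (w₀ l).support ⊆ T) ∧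
      (∑ l, C (c₀ l) * w₀ l ^ 2) = C (c i) * w i ^ 2 * (C (c' j) * v j ^ 2) ∧
      (∑ l, sqMass (c₀ l) (w₀ l)) ≤ sqMass (c i) (w i) * sqMass (c' j) (v j) := by
    intro i j
    have hsupp : (w i * v j).support ⊆ T := (support_mul_subset_image (h1 i) (h1' j)).trans fun n hn => by
      obtain ⟨x, hx, rfl⟩ := Finset.mem_image.1 hn
      exact hT x.1 (Finset.mem_product.1 hx).1 x.2 (Finset.mem_product.1 hx).2
    refine rep_congr ?_ (le_of_eq (sqMass_mul_of_proper hprop (h1 i) (h1' j) (c i) (c' j)))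
      (rep_single T (c i * c' j) (w i * v j) hsupp le_rfl)
    rw [C_mul]; ring
  have hall := rep_sum (Finset.univ : Finset (Fin s)) T _ _ fun i _ =>
    rep_sum (Finset.univ : Finset (Fin s')) T _ _ fun j _ => hone i j
  refine rep_congr ?_ ?_ hall
  · rw [← h2, ← h2', Finset.sum_mul_sum]
  · rw [← Finset.sum_mul_sum]
    have h0 : 0 ≤ ∑ j, sqMass (c' j) (v j) := Finset.sum_nonneg fun j _ => sqMass_nonneg _ _
    have h0' : 0 ≤ mF := le_trans (Finset.sum_nonneg fun i _ => sqMass_nonneg _ _) h3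
    exact mul_le_mul h3 h3' h0 h0'

/-- **Exponential patterns on a proper rank-two progression block are cheap** (`O(log k₁ · log k₂)`).  For
`k₁, k₂ ≥ 1`, step `q ≥ k₁` (so that `[0,k₁) + q·[0,k₂)` is a proper generalised progression), unimodular
`u₁, u₂`, shifts `d, d'` and `S ⊇ (d + P) ∪ (d' + P)`, `P = [0,k₁) + q·[0,k₂)`: the pattern
`X^{d+d'} (Σ_{n<2k₁−1} u₁^n X^n)(Σ_{m<2k₂−1} u₂^m X^{qm})` is `Σ_j c_j w_j²` with `supp w_j ⊆ S` and mass
`≤ (Nat.log 2 k₁ + 5/2)(Nat.log 2 k₂ + 5/2)`.  (For `q ≥ 2k₁ − 1` and `u₁ = u₂ = 1` this is the all-ones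
pattern on the proper sumset `P + P`.) [folklore] -/
theorem exp_gapBlock_rep (k₁ k₂ q : ℕ) (hk₁ : 1 ≤ k₁) (hk₂ : 1 ≤ k₂) (hq : k₁ ≤ q) (u₁ u₂ : ℂ)
    (hu₁ : ‖u₁‖ = 1) (hu₂ : ‖u₂‖ = 1) (d d' : ℕ) (S : Finset ℕ)
    (hd : ∀ i, i < k₁ → ∀ j, j < k₂ → d + (i + q * j) ∈ S)
    (hd' : ∀ i, i < k₁ → ∀ j, j < k₂ → d' + (i + q * j) ∈ S) :
    ∃ (s : ℕ) (c : Fin s → ℂ) (w : Fin s → ℂ[X]), (∀ j, (w j).support ⊆ S) ∧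
      (∑ j, C (c j) * w j ^ 2) =
        X ^ (d + d') * ((∑ n ∈ range (2 * k₁ - 1), C (u₁ ^ n) * (X : ℂ[X]) ^ n) *
          ∑ n ∈ range (2 * k₂ - 1), C (u₂ ^ n) * (X : ℂ[X]) ^ (q * n)) ∧
      (∑ j, sqMass (c j) (w j)) ≤ ((Nat.log 2 k₁ : ℝ) + 5 / 2) * ((Nat.log 2 k₂ : ℝ) + 5 / 2) := by
  classical
  have hq0 : 0 < q := by omega
  have hA := exp_rep k₁ hk₁ u₁ hu₁
  have hpat : expand ℂ q (∑ n ∈ range (2 * k₂ - 1), C (u₂ ^ n) * (X : ℂ[X]) ^ n) =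
      ∑ n ∈ range (2 * k₂ - 1), C (u₂ ^ n) * (X : ℂ[X]) ^ (q * n) := by
    rw [map_sum]
    exact Finset.sum_congr rfl fun n _ => by rw [map_mul, expand_C, map_pow (expand ℂ q), expand_X, ← pow_mul]
  have hB := rep_congr hpat le_rfl (rep_expand hq0 (exp_rep k₂ hk₂ u₂ hu₂))
  -- properness of `[0,k₁) + q·[0,k₂)` for `k₁ ≤ q`
  have hprop : ∀ a₁ ∈ range k₁, ∀ b₁ ∈ (range k₂).image (fun a => q * a),
      ∀ a₂ ∈ range k₁, ∀ b₂ ∈ (range k₂).image (fun a => q * a), a₁ + b₁ = a₂ + b₂ → a₁ = a₂ := by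
    intro a₁ ha₁ b₁ hb₁ a₂ ha₂ b₂ hb₂ heq
    obtain ⟨j₁, -, rfl⟩ := Finset.mem_image.1 hb₁
    obtain ⟨j₂, -, rfl⟩ := Finset.mem_image.1 hb₂
    have h₁ : a₁ < q := lt_of_lt_of_le (mem_range.1 ha₁) hq
    have h₂ : a₂ < q := lt_of_lt_of_le (mem_range.1 ha₂) hq
    have e₁ : (a₁ + q * j₁) % q = a₁ := by rw [Nat.add_mul_mod_self_left, Nat.mod_eq_of_lt h₁]
    have e₂ : (a₂ + q * j₂) % q = a₂ := by rw [Nat.add_mul_mod_self_left, Nat.mod_eq_of_lt h₂]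
    rw [← e₁, ← e₂, heq]
  set P : Finset ℕ := (range k₁ ×ˢ (range k₂).image (fun a => q * a)).image (fun x => x.1 + x.2) with hP
  have hPT : ∀ a ∈ range k₁, ∀ b ∈ (range k₂).image (fun a => q * a), a + b ∈ P := fun a ha b hb =>
    Finset.mem_image.2 ⟨(a, b), Finset.mem_product.2 ⟨ha, hb⟩, rfl⟩
  have hAB := rep_mul hprop hPT hA hB
  have hmemP : ∀ g ∈ P, ∃ i, i < k₁ ∧ ∃ j, j < k₂ ∧ g = i + q * j := by
    intro g hg
    obtain ⟨x, hx, rfl⟩ := Finset.mem_image.1 hg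
    obtain ⟨hx1, hx2⟩ := Finset.mem_product.1 hx
    obtain ⟨j, hj, hx2'⟩ := Finset.mem_image.1 hx2
    exact ⟨x.1, mem_range.1 hx1, j, mem_range.1 hj, by rw [← hx2']⟩
  refine rep_shift_two' d d' S ?_ ?_ hAB
  · intro g hg
    obtain ⟨i, hi, j, hj, rfl⟩ := hmemP g hg
    exact hd i hi j hj
  · intro g hg
    obtain ⟨i, hi, j, hj, rfl⟩ := hmemP g hg
    exact hd' i hi j hj

end

end Summit.ValiantsHypothesis.ValiantsHypothesis.Theorems.FeketeSOSHardPaleyRIP
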